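/- Width seat `ym-line-cbag-p1-w3` (prover-ym-line-cbag-p1-w3-g0-0), route `ColdBoxAllGroups`, crux `BoxFloorAllGroups`
(stmt-QuantumFields-22254), line `birth`, skeleton v4: glue «CubicG» toward the lead's load-bearing stub S2
`stub_boxDirichletDominationAbsG` (the one-scale expansion in the exponential chart). -/
import Summits.QuantumFields.YangMills.Theorems.EquipartitionCriticalityFreeEnergyLogCoefficientExpChartBasic
import Summits.QuantumFields.YangMills.Theorems.UnitScaleTiltFluctuationComparisonRegPrLiftSecondOrder
import Literature.MathematicalPhysics.QuantumFieldTheory.WilsonPlaquetteWeakCouplingFloor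
import Literature.MathematicalPhysics.QuantumLattice.BalabanBlockAverage
import Mathlib.Analysis.Complex.Exponential

/-!
# Crux `BoxFloorAllGroups`, glue «CubicG»: the CUBIC REMAINDER of the plaquette Wilson cost in the exponential chart of a
# compact group presented in `U(N)` — `|(N − Re tr e^{A₁}e^{A₂}e^{A₃}e^{A₄}) − ½‖A₁+A₂+A₃+A₄‖_F²| ≤ 190·m³`

The `G`-generic replacement of the `SU(2)` brick `WeakCouplingRatesColdBoxCubic.abs_plaquetteCost_sub_sq_norm_le` (there: pure-imaginary
quaternions in the gnomonic chart, constant `362`), for the all-groups crux `BoxFloorAllGroups` of route `ColdBoxAllGroups` (skeleton v4,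
stub S2: the one-scale Laplace expansion of the cold-wall box of EVERY compact simple `G` runs in the exponential chart
`FreeEnergyLogCoefficient.expChart ρ` of the faithful unitary representation `ρ`).  Frobenius norms throughout.

* §1 (any complete normed algebra) `norm_exp_sub_one_sub_le` — `‖e^X − 1 − X‖ ≤ 2‖X‖²` for `‖X‖ ≤ 1` (from the tree's
  `norm_exp_sub_exp_sub_le` at `Y = 0` and `e^r − 1 ≤ r + r²`, Mathlib `Real.abs_exp_sub_one_sub_id_le`); `norm_exp_sub_one_le'` —
  `‖e^X − 1‖ ≤ (3/2)‖X‖` for `‖X‖ ≤ 1/4`; with the tree's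
  `ApproxLift.norm_prod_four_sub_le` (`‖(1+X₁)(1+X₂)(1+X₃)(1+X₄) − 1 − ΣXᵢ‖ ≤ 6m² + 4m³ + m⁴` for `‖Xᵢ‖ ≤ m`):
  **`norm_exp_mul_exp_mul_exp_mul_exp_sub_one_sub_le`** — `‖e^{A₁}e^{A₂}e^{A₃}e^{A₄} − 1 − (A₁+A₂+A₃+A₄)‖ ≤ 26·m²` for `‖Aᵢ‖ ≤ m ≤ 1/4`.
* §2 (`M_N(ℂ)`, Frobenius) with the tree's `sub_re_trace_eq_half_norm_sub_one_sq` (`N − Re tr U = ½‖U − 1‖_F²` for unitary `U`)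
  and the scalar step `abs_half_norm_sq_sub_half_norm_sq_le`:
  **`abs_cost_exp_prod_sub_half_norm_sq_le`** — for SKEW-HERMITIAN `A₁,…,A₄` with `‖Aᵢ‖_F ≤ m ≤ 1/4`:
  `|(N − Re tr(e^{A₁}e^{A₂}e^{A₃}e^{A₄})) − ½‖A₁+A₂+A₃+A₄‖_F²| ≤ 190·m³`; the plaquette form with inverted links
  `abs_cost_exp_holonomy_sub_half_norm_sq_le` (`e^{A₁}e^{A₂}(e^{A₃})⁻¹(e^{A₄})⁻¹`, linear circulation `A₁+A₂−A₃−A₄`).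
* §3 (the chart) **`abs_cost_expChart_holonomy_sub_half_norm_sq_le`** — for a continuous unitary-valued `ρ : G →* U(N)` and chart
  coordinates `a₁,…,a₄ ∈ ℝ^D`, `‖aᵢ‖ ≤ m ≤ 1/4`, with `gᵢ = expChart ρ aᵢ`:
  `|(N − Re tr ρ(g₁ g₂ g₃⁻¹ g₄⁻¹)) − ½‖a₁ + a₂ − a₃ − a₄‖²| ≤ 190·m³` (`lieIso ρ` is an isometry onto skew-Hermitian matrices and
  `ρ(expChart ρ a) = e^{lieIso ρ a}`).  With `a = t/√β` this is the uniform Taylor input «`β·cost_p = ½|s(p)|² + O(β m³)`», `s(p)` the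
  `D`-component Dirichlet circulation, of the one-scale expansion (S2).

Everything is proved; no definition, no named fact; standard axioms.  NOT a statement about the Yang–Mills mass gap (rung-level support,
RECORD label).
-/

set_option autoImplicit false

noncomputable section

open scoped Matrix Matrix.Norms.Frobenius
open NormedSpace

namespace Summit.QuantumFields.YangMills.Theorems.ColdBoxAllGroups

/-! ## §1 Power-series bookkeeping in a complete normed algebra -/

section Banach

variable {𝔸 : Type*} [NormedRing 𝔸] [NormedAlgebra ℝ 𝔸] [CompleteSpace 𝔸]

/-- **Second-order Taylor bound of the exponential at `0`**: `‖e^X − 1 − X‖ ≤ 2‖X‖²` for `‖X‖ ≤ 1`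
(`‖(e^X − e^0) − (X − 0)‖ ≤ (e^{‖X‖} − 1)‖X‖` and `e^r − 1 ≤ r + r² ≤ 2r` on `[0, 1]`). -/
theorem norm_exp_sub_one_sub_le {X : 𝔸} (hX : ‖X‖ ≤ 1) : ‖exp X - 1 - X‖ ≤ 2 * ‖X‖ ^ 2 := by
  have h := FreeEnergyLogCoefficient.norm_exp_sub_exp_sub_le (X := X) (Y := 0) (r := ‖X‖) le_rfl (by simp)
  rw [exp_zero, sub_zero] at h
  have hr0 : 0 ≤ ‖X‖ := norm_nonneg X
  have hexp : Real.exp ‖X‖ - 1 ≤ ‖X‖ + ‖X‖ ^ 2 := by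
    have := Real.abs_exp_sub_one_sub_id_le (x := ‖X‖) (by rwa [abs_of_nonneg hr0])
    rw [abs_le] at this
    linarith [this.2]
  calc ‖exp X - 1 - X‖ ≤ (Real.exp ‖X‖ - 1) * ‖X‖ := h
    _ ≤ (‖X‖ + ‖X‖ ^ 2) * ‖X‖ := mul_le_mul_of_nonneg_right hexp hr0
    _ ≤ 2 * ‖X‖ ^ 2 := by nlinarith

/-- `‖e^X − 1‖ ≤ ‖X‖ + 2‖X‖²`, hence `≤ (3/2)‖X‖`, for `‖X‖ ≤ 1/4`. -/
theorem norm_exp_sub_one_le' {X : 𝔸} (hX : ‖X‖ ≤ 1 / 4) : ‖exp X - 1‖ ≤ 3 / 2 * ‖X‖ := by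
  have h := norm_exp_sub_one_sub_le (X := X) (by linarith)
  have e : exp X - 1 = (exp X - 1 - X) + X := by abel
  calc ‖exp X - 1‖ = ‖(exp X - 1 - X) + X‖ := by rw [← e]
    _ ≤ ‖exp X - 1 - X‖ + ‖X‖ := norm_add_le _ _
    _ ≤ 2 * ‖X‖ ^ 2 + ‖X‖ := by linarith
    _ ≤ 3 / 2 * ‖X‖ := by nlinarith [norm_nonneg X]

/-- **Second-order expansion of a product of four exponentials**: for `‖Aᵢ‖ ≤ m ≤ 1/4`,
`‖e^{A₁}e^{A₂}e^{A₃}e^{A₄} − 1 − (A₁+A₂+A₃+A₄)‖ ≤ 26·m²` (`e^{Aᵢ} = 1 + Aᵢ + Rᵢ`, `‖Rᵢ‖ ≤ 2m²`, `‖e^{Aᵢ} − 1‖ ≤ (3/2)m`, and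
the tree's `ApproxLift.norm_prod_four_sub_le` at radius `(3/2)m`). -/
theorem norm_exp_mul_exp_mul_exp_mul_exp_sub_one_sub_le {A₁ A₂ A₃ A₄ : 𝔸} {m : ℝ} (hm : m ≤ 1 / 4) (h₁ : ‖A₁‖ ≤ m)
    (h₂ : ‖A₂‖ ≤ m) (h₃ : ‖A₃‖ ≤ m) (h₄ : ‖A₄‖ ≤ m) :
    ‖exp A₁ * exp A₂ * exp A₃ * exp A₄ - 1 - (A₁ + A₂ + A₃ + A₄)‖ ≤ 26 * m ^ 2 := by
  have hm0 : 0 ≤ m := (norm_nonneg _).trans h₁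
  -- first-order pieces `Xᵢ = e^{Aᵢ} − 1` and remainders `Rᵢ = Xᵢ − Aᵢ`
  have hX : ∀ {A : 𝔸}, ‖A‖ ≤ m → ‖exp A - 1‖ ≤ 3 / 2 * m := fun {A} hA =>
    (norm_exp_sub_one_le' (hA.trans hm)).trans (by linarith)
  have hR : ∀ {A : 𝔸}, ‖A‖ ≤ m → ‖exp A - 1 - A‖ ≤ 2 * m ^ 2 := fun {A} hA =>
    (norm_exp_sub_one_sub_le (hA.trans (hm.trans (by norm_num)))).trans
      (by nlinarith [norm_nonneg A, pow_le_pow_left₀ (norm_nonneg _) hA 2])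
  have hprod := ApproxLift.norm_prod_four_sub_le (hX h₁) (hX h₂) (hX h₃) (hX h₄)
  have e1 : (1 + (exp A₁ - 1)) * (1 + (exp A₂ - 1)) * (1 + (exp A₃ - 1)) * (1 + (exp A₄ - 1)) =
      exp A₁ * exp A₂ * exp A₃ * exp A₄ := by simp
  rw [e1] at hprod
  have e2 : exp A₁ * exp A₂ * exp A₃ * exp A₄ - 1 - (A₁ + A₂ + A₃ + A₄) =
      (exp A₁ * exp A₂ * exp A₃ * exp A₄ - 1 - ((exp A₁ - 1) + (exp A₂ - 1) + (exp A₃ - 1) + (exp A₄ - 1))) +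
        ((exp A₁ - 1 - A₁) + (exp A₂ - 1 - A₂) + (exp A₃ - 1 - A₃) + (exp A₄ - 1 - A₄)) := by abel
  rw [e2]
  have hsumR : ‖(exp A₁ - 1 - A₁) + (exp A₂ - 1 - A₂) + (exp A₃ - 1 - A₃) + (exp A₄ - 1 - A₄)‖ ≤ 8 * m ^ 2 := by
    have := norm_add_le ((exp A₁ - 1 - A₁) + (exp A₂ - 1 - A₂) + (exp A₃ - 1 - A₃)) (exp A₄ - 1 - A₄)
    have := norm_add_le ((exp A₁ - 1 - A₁) + (exp A₂ - 1 - A₂)) (exp A₃ - 1 - A₃)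
    have := norm_add_le (exp A₁ - 1 - A₁) (exp A₂ - 1 - A₂)
    linarith [hR h₁, hR h₂, hR h₃, hR h₄]
  have hpoly : 6 * (3 / 2 * m) ^ 2 + 4 * (3 / 2 * m) ^ 3 + (3 / 2 * m) ^ 4 ≤ 18 * m ^ 2 := by
    have hm2 : 0 ≤ m ^ 2 := sq_nonneg m
    have h3 : m ^ 2 * m ≤ m ^ 2 * (1 / 4) := mul_le_mul_of_nonneg_left hm hm2
    have hm16 : m ^ 2 ≤ 1 / 16 := by nlinarith
    have h4 : m ^ 2 * m ^ 2 ≤ m ^ 2 * (1 / 16) := mul_le_mul_of_nonneg_left hm16 hm2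
    nlinarith
  exact (norm_add_le _ _).trans (by linarith)

end Banach

/-! ## §2 The plaquette cost of four exponentials of skew-Hermitian matrices -/

section Matrices

variable {N : ℕ}

/-- Scalar step: if `‖E‖ ≤ e` and `‖s‖ ≤ 4m` then `|½‖s + E‖² − ½‖s‖²| ≤ 4m·e + e²/2`. -/
theorem abs_half_norm_sq_sub_half_norm_sq_le {E' : Type*} [SeminormedAddCommGroup E'] {s E : E'} {m e : ℝ}
    (hs : ‖s‖ ≤ 4 * m) (hE : ‖E‖ ≤ e) :
    |‖s + E‖ ^ 2 / 2 - ‖s‖ ^ 2 / 2| ≤ 4 * m * e + e ^ 2 / 2 := by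
  have h1 : ‖s + E‖ ≤ ‖s‖ + ‖E‖ := norm_add_le _ _
  have h2 : ‖s‖ ≤ ‖s + E‖ + ‖E‖ := by
    have := norm_sub_le (s + E) E; rwa [add_sub_cancel_right] at this
  have hs0 := norm_nonneg s
  have hE0 := norm_nonneg E
  have hsE0 := norm_nonneg (s + E)
  rw [abs_le]
  constructor <;> nlinarith

/-- **Cubic remainder of the plaquette cost in exponential coordinates** (matrix form): for skew-Hermitian `A₁,…,A₄` with
`‖Aᵢ‖_F ≤ m ≤ 1/4`, `|(N − Re tr(e^{A₁}e^{A₂}e^{A₃}e^{A₄})) − ½‖A₁+A₂+A₃+A₄‖_F²| ≤ 190·m³`. -/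
theorem abs_cost_exp_prod_sub_half_norm_sq_le {A₁ A₂ A₃ A₄ : Matrix (Fin N) (Fin N) ℂ} (hA₁ : A₁ᴴ = -A₁) (hA₂ : A₂ᴴ = -A₂)
    (hA₃ : A₃ᴴ = -A₃) (hA₄ : A₄ᴴ = -A₄) {m : ℝ} (hm : m ≤ 1 / 4) (h₁ : ‖A₁‖ ≤ m) (h₂ : ‖A₂‖ ≤ m) (h₃ : ‖A₃‖ ≤ m)
    (h₄ : ‖A₄‖ ≤ m) :
    |((N : ℝ) - (exp A₁ * exp A₂ * exp A₃ * exp A₄).trace.re) - ‖A₁ + A₂ + A₃ + A₄‖ ^ 2 / 2| ≤ 190 * m ^ 3 := by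
  have hm0 : 0 ≤ m := (norm_nonneg _).trans h₁
  have hU : exp A₁ * exp A₂ * exp A₃ * exp A₄ ∈ Matrix.unitaryGroup (Fin N) ℂ :=
    mul_mem (mul_mem (mul_mem (FreeEnergyLogCoefficient.exp_mem_unitaryGroup_of_skew hA₁)
      (FreeEnergyLogCoefficient.exp_mem_unitaryGroup_of_skew hA₂))
      (FreeEnergyLogCoefficient.exp_mem_unitaryGroup_of_skew hA₃)) (FreeEnergyLogCoefficient.exp_mem_unitaryGroup_of_skew hA₄)
  rw [Literature.MathematicalPhysics.QuantumFieldTheory.sub_re_trace_eq_half_norm_sub_one_sq hU]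
  set s := A₁ + A₂ + A₃ + A₄ with hs
  set E := exp A₁ * exp A₂ * exp A₃ * exp A₄ - 1 - s with hE
  have hEs : exp A₁ * exp A₂ * exp A₃ * exp A₄ - 1 = s + E := by rw [hE]; abel
  have hEle : ‖E‖ ≤ 26 * m ^ 2 := norm_exp_mul_exp_mul_exp_mul_exp_sub_one_sub_le hm h₁ h₂ h₃ h₄
  have hsle : ‖s‖ ≤ 4 * m := by
    have := norm_add_le (A₁ + A₂ + A₃) A₄
    have := norm_add_le (A₁ + A₂) A₃
    have := norm_add_le A₁ A₂
    rw [hs]; linarith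
  rw [hEs]
  refine (abs_half_norm_sq_sub_half_norm_sq_le hsle hEle).trans ?_
  nlinarith [pow_le_pow_left₀ hm0 hm 1]

/-- The matrix exponential inverts by negation: `(e^{A})⁻¹ = e^{−A}` (Mathlib `Matrix.exp_neg`). -/
theorem inv_exp_eq_exp_neg (A : Matrix (Fin N) (Fin N) ℂ) : (exp A)⁻¹ = exp (-A) := (Matrix.exp_neg A).symm

/-- **Cubic remainder, plaquette form**: for skew-Hermitian `A₁,…,A₄` with `‖Aᵢ‖_F ≤ m ≤ 1/4`, the cost of the holonomy
`e^{A₁}e^{A₂}(e^{A₃})⁻¹(e^{A₄})⁻¹` is `½‖A₁+A₂−A₃−A₄‖_F²` up to `190·m³`. -/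
theorem abs_cost_exp_holonomy_sub_half_norm_sq_le {A₁ A₂ A₃ A₄ : Matrix (Fin N) (Fin N) ℂ} (hA₁ : A₁ᴴ = -A₁) (hA₂ : A₂ᴴ = -A₂)
    (hA₃ : A₃ᴴ = -A₃) (hA₄ : A₄ᴴ = -A₄) {m : ℝ} (hm : m ≤ 1 / 4) (h₁ : ‖A₁‖ ≤ m) (h₂ : ‖A₂‖ ≤ m) (h₃ : ‖A₃‖ ≤ m)
    (h₄ : ‖A₄‖ ≤ m) :
    |((N : ℝ) - (exp A₁ * exp A₂ * (exp A₃)⁻¹ * (exp A₄)⁻¹).trace.re) - ‖A₁ + A₂ - A₃ - A₄‖ ^ 2 / 2| ≤ 190 * m ^ 3 := by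
  rw [inv_exp_eq_exp_neg, inv_exp_eq_exp_neg]
  have hA₃' : (-A₃)ᴴ = -(-A₃) := by rw [Matrix.conjTranspose_neg, hA₃]
  have hA₄' : (-A₄)ᴴ = -(-A₄) := by rw [Matrix.conjTranspose_neg, hA₄]
  have h := abs_cost_exp_prod_sub_half_norm_sq_le hA₁ hA₂ hA₃' hA₄' hm h₁ h₂ (by rwa [norm_neg]) (by rwa [norm_neg])
  have e : A₁ + A₂ + -A₃ + -A₄ = A₁ + A₂ - A₃ - A₄ := by abel
  rwa [e] at h

end Matrices

/-! ## §3 The plaquette cost in the exponential chart `expChart ρ` -/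

section Chart

open Summit.QuantumFields.YangMills.Theorems.FreeEnergyLogCoefficient

variable {N : ℕ} {G : Type*} [Group G] [TopologicalSpace G] [CompactSpace G] (ρ : G →* Matrix (Fin N) (Fin N) ℂ)

/-- In the chart, inverted links are exponentials of negated coordinates: `ρ((expChart ρ a)⁻¹) = e^{−lieIso ρ a}`. -/
theorem rho_expChart_inv (hρ : Continuous ρ) (a : EuclideanSpace ℝ (Fin (dimE ρ))) :
    ρ (expChart ρ a)⁻¹ = exp (-(lieIso ρ a)) := by
  rw [Literature.MathematicalPhysics.QuantumLattice.map_inv_eq_nonsing_inv, rho_expChart ρ hρ, inv_exp_eq_exp_neg]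

/-- **Cubic remainder of the plaquette cost in the exponential chart.**  For a continuous unitary-valued `ρ : G →* U(N)` and
chart coordinates `a₁, a₂, a₃, a₄ ∈ ℝ^D` (`D = dimE ρ`) with `‖aᵢ‖ ≤ m ≤ 1/4`, the links `gᵢ = expChart ρ aᵢ` satisfy
`|(N − Re tr ρ(g₁ g₂ g₃⁻¹ g₄⁻¹)) − ½‖a₁ + a₂ − a₃ − a₄‖²| ≤ 190·m³`: the plaquette Wilson cost is the half squared Euclidean norm
of the LINEAR circulation of the chart coordinates up to a cubic remainder (`ρ(expChart ρ a) = e^{lieIso ρ a}`, `lieIso ρ` a linear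
isometry onto skew-Hermitian matrices). -/
theorem abs_cost_expChart_holonomy_sub_half_norm_sq_le (hρ : Continuous ρ)
    (a₁ a₂ a₃ a₄ : EuclideanSpace ℝ (Fin (dimE ρ))) {m : ℝ} (hm : m ≤ 1 / 4) (h₁ : ‖a₁‖ ≤ m) (h₂ : ‖a₂‖ ≤ m)
    (h₃ : ‖a₃‖ ≤ m) (h₄ : ‖a₄‖ ≤ m) :
    |((N : ℝ) - (ρ (expChart ρ a₁ * expChart ρ a₂ * (expChart ρ a₃)⁻¹ * (expChart ρ a₄)⁻¹)).trace.re) -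
        ‖a₁ + a₂ - a₃ - a₄‖ ^ 2 / 2| ≤ 190 * m ^ 3 := by
  rw [map_mul, map_mul, map_mul, rho_expChart_inv ρ hρ, rho_expChart_inv ρ hρ, rho_expChart ρ hρ, rho_expChart ρ hρ]
  have hn : ‖a₁ + a₂ - a₃ - a₄‖ = ‖lieIso ρ a₁ + lieIso ρ a₂ + -lieIso ρ a₃ + -lieIso ρ a₄‖ := by
    rw [← sub_eq_add_neg, ← sub_eq_add_neg, ← map_add, ← map_sub, ← map_sub, norm_lieIso]
  rw [hn]
  have hA₃ : (-lieIso ρ a₃)ᴴ = -(-lieIso ρ a₃) := by rw [Matrix.conjTranspose_neg, conjTranspose_lieIso]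
  have hA₄ : (-lieIso ρ a₄)ᴴ = -(-lieIso ρ a₄) := by rw [Matrix.conjTranspose_neg, conjTranspose_lieIso]
  exact abs_cost_exp_prod_sub_half_norm_sq_le (conjTranspose_lieIso ρ a₁) (conjTranspose_lieIso ρ a₂) hA₃ hA₄ hm
    (by rw [norm_lieIso]; exact h₁) (by rw [norm_lieIso]; exact h₂) (by rw [norm_neg, norm_lieIso]; exact h₃)
    (by rw [norm_neg, norm_lieIso]; exact h₄)

end Chart

end Summit.QuantumFields.YangMills.Theorems.ColdBoxAllGroups

end
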